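import Summits.CriticalPhenomena.PercolationContinuityZ3.Theorems.SahiMasterFamilyThreePartitionOneNested
import Summits.CriticalPhenomena.PercolationContinuityZ3.Theorems.SahiMasterFamilyThreePartitionCommonCoreCyclic
import Summits.CriticalPhenomena.PercolationContinuityZ3.Theorems.SahiMasterFamilyThreePartitionOneMeetZeroEqual
import Summits.CriticalPhenomena.PercolationContinuityZ3.Theorems.SahiMasterFamilyThreePartitionZeroNested
import Summits.CriticalPhenomena.PercolationContinuityZ3.Theorems.SahiMasterFamilyThreePartitionPairwiseMeet
import Summits.CriticalPhenomena.PercolationContinuityZ3.Theorems.SahiMasterFamilyThreePartitionEqualZeroMeets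
import Summits.CriticalPhenomena.PercolationContinuityZ3.Theorems.SahiMasterFamilyThreePartitionMaxClass25
import Summits.CriticalPhenomena.PercolationContinuityZ3.Theorems.PercNearOneGluingNoHeavyLowerTailThreePartitionConeClosure
import Summits.CriticalPhenomena.PercolationContinuityZ3.Theorems.PercNearOneGluingNoHeavyLowerTailThreePartitionPrincipalCombPos
import Summits.CriticalPhenomena.PercolationContinuityZ3.Theorems.PercNearOneGluingNoHeavyLowerTailThreePartitionCombBridgeConverse
import HarnessLib

/-!
# The RECURSIVE CLASS `𝒦` of up-set triples is comb-positive: `(M⁺-3)` on `𝒦` (unit `prim-master-conj`, gen 34;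
# `--supports stmt-CriticalPhenomena-4575`)

Memo `run/shared/lean/prim/prim-l12/prim-master-conj/POINTWISE.md` §34 (V4), §35.  `InK` is the smallest class of triples of up-sets
`(𝒰, 𝒱, 𝒲) ⊆ 𝒫(ι)³` containing the BASE strata (a principal/cylinder member `{T | S ⊆ T}` — `…TwistedPrincipal`; an empty member; a
nested pair — `…VOrderNested`/`…VOrderReverseNested`, i.e. CONJ-V on nested pairs; and every NON-RESIDUAL triple of
`…CombBridgeConverse`: independent member, disjoint supports, meet-containing member), closed under the slot symmetries and under the
coordinate steps CONE (`𝒰⁰_e = ∅`, contraction minor; `…TwistedCone`/`…TwistedConeTwo`), PAIRWISE-ZERO-MEET, EQUAL-ZERO-MEETS and MAX-CLASS-25 (`…PairwiseMeet`, `…EqualZeroMeets`, `…MaxClass25`; maximal product classes of the gen-34 LP census), ONE-NESTED (`𝒰¹_e ⊆ 𝒱¹_e`, deletion minor;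
`…ThreePartitionOneNested` = THEOREM 1N), ONE-MEET, ZERO-EQUAL (`…OneMeetZeroEqual`), COMMON-CORE, CYCLIC (`…CommonCoreCyclic`), each
with its `e`-free "needs".  **THEOREM (`InK.threePartNT_nonneg`)**: every triple of `𝒦` has `threePartNT τ 𝒰 𝒱 𝒲 ≥ 0` for EVERY
twist `τ` — by structural induction, all analytic content being the tree's four-functions / robust-matching theorems and the
kernel-checked type-space certificates of gen 33/34.  COROLLARY (`combPos_sahiE_three_of_inK_sections`): if all subcube section
triples of `(U,V,W)` lie in `𝒦` then `E₃(μ_p; 1_U,1_V,1_W)` is comb-positive (`…ThreePartitionCombBridge`), hence `≥ 0` at every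
product measure.  COVERAGE (computational evidence, NOT in Lean; gen 33 `code-g33/coverage4.c`): with the memo's base strata `𝒦`
contains all `790 244` up-set triples on `≤ 4` coordinates and > 99.8 % of random triples on 5–6 coordinates (the Lean class has the
same base strata and steps).  No `sorry`, standard axioms, nothing conditional.
HONEST LABEL: `(M⁺-3)` on a recursively defined class — a reduction of Kahn/Sahi `C₃` to "every triple is in `𝒦`", which is
OPEN (the general type-space step has a pseudo-count, POINTWISE §34 (V2)); not a proof of the crux. [this work]
-/

noncomputable section

open Finset
open scoped symmDiff Classical

namespace Summit.CriticalPhenomena.PercolationContinuityZ3.Theorems.ThreePartition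

namespace TypedSlice

variable {ι : Type*}

/-! ## The recursive class 𝒦 -/

section RecursiveClass

variable {ι : Type} [Fintype ι]

/-- **The recursive class `𝒦`** of up-set triples (POINTWISE §34 (V4)): generated by the BASE strata — a principal (cylinder) member
`{T | S ⊆ T}` (incl. `univ`), an empty member, a nested pair, and generally every NON-RESIDUAL triple of the tree
(`threePartNT_nonneg_of_not_residual`: comparable pair / cylinder member / independent member / disjoint supports / meet-containing
member) — and closed under the slot symmetries and the coordinate STEPS CONE
(`𝒰⁰_e = ∅`, needs the contraction minor), ONE-NESTED (`𝒰¹_e ⊆ 𝒱¹_e`, needs the deletion minor), ONE-MEET (`𝒰¹∩𝒱¹ ⊆ 𝒲¹`), ZERO-EQUAL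
(`𝒰⁰ = 𝒱⁰`), ZERO-NESTED (`𝒰⁰ ⊆ 𝒱⁰ ∩ 𝒲⁰`), COMMON-CORE, CYCLIC, PAIRWISE-ZERO-MEET (`𝒰_i⁰∩𝒰_j⁰ ⊆ 𝒰_k¹`, contains the previous two), EQUAL-ZERO-MEETS (`𝒰⁰∩𝒱⁰ = 𝒰⁰∩𝒲⁰`), MAX-CLASS-25 (`{011,122}ᶜ`, the largest certifiable product class) (each with its "needs": `e`-free section triples, lifted to `ι`, written as threshold families `thrSet`),
and under the GENERIC CERTIFICATE STEP `cert`: any pair of type-space certificates (profiles `e ∉ τ` / `e ∈ τ`; data `d, L, I` of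
`…TypedSliceCert`, validity `check … = true` supplied by the user, e.g. by `decide +kernel`) for a product class of types `R` (27-bit
mask) realised by the triple at `e`, with the IH triples in the class — so `𝒦` grows with every new certificate WITHOUT new Lean files.
Every constructor records that the three families are up-sets. [this work] -/
inductive InK : Set (Set ι) → Set (Set ι) → Set (Set ι) → Prop
  | principal (S : Set ι) {𝒱 𝒲 : Set (Set ι)} (h𝒱 : IsUpperSet 𝒱) (h𝒲 : IsUpperSet 𝒲) : InK {T : Set ι | S ⊆ T} 𝒱 𝒲
  | empty {𝒱 𝒲 : Set (Set ι)} (h𝒱 : IsUpperSet 𝒱) (h𝒲 : IsUpperSet 𝒲) : InK ∅ 𝒱 𝒲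
  | nested {𝒰 𝒱 𝒲 : Set (Set ι)} (h𝒰 : IsUpperSet 𝒰) (h𝒱 : IsUpperSet 𝒱) (h𝒲 : IsUpperSet 𝒲)
      (h : 𝒱 ⊆ 𝒲 ∨ 𝒲 ⊆ 𝒱 ∨ 𝒰 ⊆ 𝒲 ∨ 𝒲 ⊆ 𝒰 ∨ 𝒰 ⊆ 𝒱 ∨ 𝒱 ⊆ 𝒰) : InK 𝒰 𝒱 𝒲
  | strata (U : Fin 3 → Set (Set ι)) (hU : ∀ j, IsUpperSet (U j))
      (h : (∃ i j : Fin 3, j ≠ i ∧ U j ⊆ U i) ∨ (∃ (m : Fin 3) (S : Set ι), U m = {ω : Set ι | S ⊆ ω}) ∨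
        (∃ (m : Fin 3) (F : Finset ι), Literature.Probability.Percolation.DeterminedBy (U m) (↑F : Set ι) ∧
          ∀ j, Literature.Probability.Percolation.DeterminedBy (U (m.succAbove j)) (↑F : Set ι)ᶜ) ∨
        (∃ m : Fin 3, SuppZeroFlag 2 (fun j => U (m.succAbove j))) ∨
        (∃ m : Fin 3, (⋂ j, U (m.succAbove j)) ⊆ U m)) : InK (U 0) (U 1) (U 2)
  | cert (e : ι) {𝒰 𝒱 𝒲 : Set (Set ι)} (h𝒰 : IsUpperSet 𝒰) (h𝒱 : IsUpperSet 𝒱) (h𝒲 : IsUpperSet 𝒲) (R : ℕ)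
      (dA dB : ℕ) (LA LB : List (ℕ × Atom)) (IA IB : List (ℕ × Ty × Ty × Ty)) (hdA : 1 ≤ dA) (hdB : 1 ≤ dB)
      (hokA : certOK LA = true) (hokB : certOK LB = true)
      (hchkA : check (inM R) (certResid false dA LA IA) = true) (hchkB : check (inM R) (certResid true dB LB IB) = true)
      (hreal : ∀ w : Set ι, inM R (typ 𝒰 𝒱 𝒲 e w) = true)
      (ih : ∀ p ∈ IA ++ IB, InK (thrSet 𝒰 𝒱 𝒲 e p.2.1) (thrSet 𝒰 𝒱 𝒲 e p.2.2.1) (thrSet 𝒰 𝒱 𝒲 e p.2.2.2)) :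
      InK 𝒰 𝒱 𝒲
  | swap12 {𝒰 𝒱 𝒲 : Set (Set ι)} (h : InK 𝒱 𝒰 𝒲) : InK 𝒰 𝒱 𝒲
  | swap23 {𝒰 𝒱 𝒲 : Set (Set ι)} (h : InK 𝒰 𝒲 𝒱) : InK 𝒰 𝒱 𝒲
  | cone (e : ι) {𝒰 𝒱 𝒲 : Set (Set ι)} (h𝒰 : IsUpperSet 𝒰) (h𝒱 : IsUpperSet 𝒱) (h𝒲 : IsUpperSet 𝒲) (he : ∀ T ∈ 𝒰, e ∈ T)
      (ih : InK {R : Set ι | insert e R ∈ 𝒰} {R : Set ι | insert e R ∈ 𝒱} {R : Set ι | insert e R ∈ 𝒲}) : InK 𝒰 𝒱 𝒲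
  | oneNested (e : ι) {𝒰 𝒱 𝒲 : Set (Set ι)} (h𝒰 : IsUpperSet 𝒰) (h𝒱 : IsUpperSet 𝒱) (h𝒲 : IsUpperSet 𝒲)
      (hUV : ∀ T : Set ι, insert e T ∈ 𝒰 → insert e T ∈ 𝒱)
      (ih : InK {T : Set ι | T \ {e} ∈ 𝒰} {T : Set ι | T \ {e} ∈ 𝒱} {T : Set ι | T \ {e} ∈ 𝒲}) : InK 𝒰 𝒱 𝒲
  | oneMeet (e : ι) {𝒰 𝒱 𝒲 : Set (Set ι)} (h𝒰 : IsUpperSet 𝒰) (h𝒱 : IsUpperSet 𝒱) (h𝒲 : IsUpperSet 𝒲)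
      (hm : ∀ T : Set ι, insert e T ∈ 𝒰 → insert e T ∈ 𝒱 → insert e T ∈ 𝒲)
      (ih1 : InK (thrSet 𝒰 𝒱 𝒲 e (mk 0 0 2)) (thrSet 𝒰 𝒱 𝒲 e (mk 0 2 0)) (thrSet 𝒰 𝒱 𝒲 e (mk 2 0 0)))
      (ih2 : InK (thrSet 𝒰 𝒱 𝒲 e (mk 0 0 1)) (thrSet 𝒰 𝒱 𝒲 e (mk 0 1 0)) (thrSet 𝒰 𝒱 𝒲 e (mk 1 0 0))) : InK 𝒰 𝒱 𝒲
  | zeroNested (e : ι) {𝒰 𝒱 𝒲 : Set (Set ι)} (h𝒰 : IsUpperSet 𝒰) (h𝒱 : IsUpperSet 𝒱) (h𝒲 : IsUpperSet 𝒲)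
      (hzn : ∀ T : Set ι, T \ {e} ∈ 𝒰 → T \ {e} ∈ 𝒱 ∧ T \ {e} ∈ 𝒲)
      (ih : InK (thrSet 𝒰 𝒱 𝒲 e (mk 0 0 1)) (thrSet 𝒰 𝒱 𝒲 e (mk 0 1 0)) (thrSet 𝒰 𝒱 𝒲 e (mk 1 0 0))) : InK 𝒰 𝒱 𝒲
  | zeroEqual (e : ι) {𝒰 𝒱 𝒲 : Set (Set ι)} (h𝒰 : IsUpperSet 𝒰) (h𝒱 : IsUpperSet 𝒱) (h𝒲 : IsUpperSet 𝒲)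
      (hz : ∀ T : Set ι, T \ {e} ∈ 𝒰 ↔ T \ {e} ∈ 𝒱)
      (ih1 : InK (thrSet 𝒰 𝒱 𝒲 e (mk 0 0 1)) (thrSet 𝒰 𝒱 𝒲 e (mk 0 1 0)) (thrSet 𝒰 𝒱 𝒲 e (mk 1 0 0)))
      (ih2 : InK (thrSet 𝒰 𝒱 𝒲 e (mk 0 0 2)) (thrSet 𝒰 𝒱 𝒲 e (mk 0 1 0)) (thrSet 𝒰 𝒱 𝒲 e (mk 0 2 0)))
      (ih3 : InK (thrSet 𝒰 𝒱 𝒲 e (mk 0 1 2)) (thrSet 𝒰 𝒱 𝒲 e (mk 1 0 0)) (thrSet 𝒰 𝒱 𝒲 e (mk 1 1 0)))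
      (ih4 : InK (thrSet 𝒰 𝒱 𝒲 e (mk 0 2 0)) (thrSet 𝒰 𝒱 𝒲 e (mk 1 0 0)) (thrSet 𝒰 𝒱 𝒲 e (mk 1 0 2)))
      (ih5 : InK (thrSet 𝒰 𝒱 𝒲 e (mk 0 2 0)) (thrSet 𝒰 𝒱 𝒲 e (mk 1 1 0)) (thrSet 𝒰 𝒱 𝒲 e (mk 1 1 2))) : InK 𝒰 𝒱 𝒲
  | pairwiseMeet (e : ι) {𝒰 𝒱 𝒲 : Set (Set ι)} (h𝒰 : IsUpperSet 𝒰) (h𝒱 : IsUpperSet 𝒱) (h𝒲 : IsUpperSet 𝒲)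
      (hUV : ∀ T : Set ι, T \ {e} ∈ 𝒰 → T \ {e} ∈ 𝒱 → insert e T ∈ 𝒲)
      (hUW : ∀ T : Set ι, T \ {e} ∈ 𝒰 → T \ {e} ∈ 𝒲 → insert e T ∈ 𝒱)
      (hVW : ∀ T : Set ι, T \ {e} ∈ 𝒱 → T \ {e} ∈ 𝒲 → insert e T ∈ 𝒰)
      (ih1 : InK (thrSet 𝒰 𝒱 𝒲 e (mk 0 0 1)) (thrSet 𝒰 𝒱 𝒲 e (mk 0 0 2)) (thrSet 𝒰 𝒱 𝒲 e (mk 2 2 0)))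
      (ih2 : InK (thrSet 𝒰 𝒱 𝒲 e (mk 0 0 1)) (thrSet 𝒰 𝒱 𝒲 e (mk 0 1 0)) (thrSet 𝒰 𝒱 𝒲 e (mk 1 0 0)))
      (ih3 : InK (thrSet 𝒰 𝒱 𝒲 e (mk 0 0 2)) (thrSet 𝒰 𝒱 𝒲 e (mk 0 2 0)) (thrSet 𝒰 𝒱 𝒲 e (mk 2 0 0)))
      (ih4 : InK (thrSet 𝒰 𝒱 𝒲 e (mk 0 1 0)) (thrSet 𝒰 𝒱 𝒲 e (mk 0 2 2)) (thrSet 𝒰 𝒱 𝒲 e (mk 2 0 1)))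
      (ih5 : InK (thrSet 𝒰 𝒱 𝒲 e (mk 0 2 0)) (thrSet 𝒰 𝒱 𝒲 e (mk 1 0 0)) (thrSet 𝒰 𝒱 𝒲 e (mk 2 0 2)))
      (ih6 : InK (thrSet 𝒰 𝒱 𝒲 e (mk 0 0 2)) (thrSet 𝒰 𝒱 𝒲 e (mk 0 1 0)) (thrSet 𝒰 𝒱 𝒲 e (mk 2 2 0)))
      (ih7 : InK (thrSet 𝒰 𝒱 𝒲 e (mk 0 1 0)) (thrSet 𝒰 𝒱 𝒲 e (mk 0 2 2)) (thrSet 𝒰 𝒱 𝒲 e (mk 2 0 0))) : InK 𝒰 𝒱 𝒲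
  | equalZeroMeets (e : ι) {𝒰 𝒱 𝒲 : Set (Set ι)} (h𝒰 : IsUpperSet 𝒰) (h𝒱 : IsUpperSet 𝒱) (h𝒲 : IsUpperSet 𝒲)
      (hUV : ∀ T : Set ι, T \ {e} ∈ 𝒰 → T \ {e} ∈ 𝒱 → T \ {e} ∈ 𝒲)
      (hUW : ∀ T : Set ι, T \ {e} ∈ 𝒰 → T \ {e} ∈ 𝒲 → T \ {e} ∈ 𝒱)
      (ih1 : InK (thrSet 𝒰 𝒱 𝒲 e (mk 0 0 1)) (thrSet 𝒰 𝒱 𝒲 e (mk 0 1 0)) (thrSet 𝒰 𝒱 𝒲 e (mk 1 0 0)))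
      (ih2 : InK (thrSet 𝒰 𝒱 𝒲 e (mk 0 0 1)) (thrSet 𝒰 𝒱 𝒲 e (mk 0 2 0)) (thrSet 𝒰 𝒱 𝒲 e (mk 2 0 0)))
      (ih3 : InK (thrSet 𝒰 𝒱 𝒲 e (mk 0 1 0)) (thrSet 𝒰 𝒱 𝒲 e (mk 0 1 2)) (thrSet 𝒰 𝒱 𝒲 e (mk 2 0 0))) : InK 𝒰 𝒱 𝒲
  | maxClass25 (e : ι) {𝒰 𝒱 𝒲 : Set (Set ι)} (h𝒰 : IsUpperSet 𝒰) (h𝒱 : IsUpperSet 𝒱) (h𝒲 : IsUpperSet 𝒲)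
      (h011 : ∀ T : Set ι, insert e T ∈ 𝒱 → insert e T ∈ 𝒲 → insert e T ∉ 𝒰 → (T \ {e} ∈ 𝒱 ∨ T \ {e} ∈ 𝒲))
      (h122 : ∀ T : Set ι, insert e T ∈ 𝒰 → T \ {e} ∈ 𝒱 → T \ {e} ∈ 𝒲 → T \ {e} ∈ 𝒰)
      (ih1 : InK (thrSet 𝒰 𝒱 𝒲 e (mk 0 0 1)) (thrSet 𝒰 𝒱 𝒲 e (mk 0 2 0)) (thrSet 𝒰 𝒱 𝒲 e (mk 1 0 0)))
      (ih2 : InK (thrSet 𝒰 𝒱 𝒲 e (mk 0 0 2)) (thrSet 𝒰 𝒱 𝒲 e (mk 0 1 0)) (thrSet 𝒰 𝒱 𝒲 e (mk 1 0 0)))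
      (ih3 : InK (thrSet 𝒰 𝒱 𝒲 e (mk 0 0 2)) (thrSet 𝒰 𝒱 𝒲 e (mk 0 2 0)) (thrSet 𝒰 𝒱 𝒲 e (mk 2 0 0)))
      (ih4 : InK (thrSet 𝒰 𝒱 𝒲 e (mk 0 0 1)) (thrSet 𝒰 𝒱 𝒲 e (mk 0 1 0)) (thrSet 𝒰 𝒱 𝒲 e (mk 1 0 0))) : InK 𝒰 𝒱 𝒲
  | commonCore (e : ι) {𝒰 𝒱 𝒲 : Set (Set ι)} (h𝒰 : IsUpperSet 𝒰) (h𝒱 : IsUpperSet 𝒱) (h𝒲 : IsUpperSet 𝒲)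
      (hcc : ∀ T : Set ι, (T \ {e} ∈ 𝒰 ∨ T \ {e} ∈ 𝒱 ∨ T \ {e} ∈ 𝒲) → insert e T ∈ 𝒰 ∧ insert e T ∈ 𝒱 ∧ insert e T ∈ 𝒲)
      (ih1 : InK (thrSet 𝒰 𝒱 𝒲 e (mk 0 0 2)) (thrSet 𝒰 𝒱 𝒲 e (mk 0 2 0)) (thrSet 𝒰 𝒱 𝒲 e (mk 2 0 0)))
      (ih2 : InK (thrSet 𝒰 𝒱 𝒲 e (mk 0 0 1)) (thrSet 𝒰 𝒱 𝒲 e (mk 0 1 0)) (thrSet 𝒰 𝒱 𝒲 e (mk 1 0 0)))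
      (ih3 : InK (thrSet 𝒰 𝒱 𝒲 e (mk 0 0 2)) (thrSet 𝒰 𝒱 𝒲 e (mk 0 1 0)) (thrSet 𝒰 𝒱 𝒲 e (mk 2 2 0))) : InK 𝒰 𝒱 𝒲
  | cyclic (e : ι) {𝒰 𝒱 𝒲 : Set (Set ι)} (h𝒰 : IsUpperSet 𝒰) (h𝒱 : IsUpperSet 𝒱) (h𝒲 : IsUpperSet 𝒲)
      (hUV : ∀ T : Set ι, T \ {e} ∈ 𝒰 → insert e T ∈ 𝒱) (hVW : ∀ T : Set ι, T \ {e} ∈ 𝒱 → insert e T ∈ 𝒲)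
      (hWU : ∀ T : Set ι, T \ {e} ∈ 𝒲 → insert e T ∈ 𝒰)
      (ih1 : InK (thrSet 𝒰 𝒱 𝒲 e (mk 0 0 1)) (thrSet 𝒰 𝒱 𝒲 e (mk 0 1 0)) (thrSet 𝒰 𝒱 𝒲 e (mk 1 0 0)))
      (ih2 : InK (thrSet 𝒰 𝒱 𝒲 e (mk 0 0 2)) (thrSet 𝒰 𝒱 𝒲 e (mk 0 1 0)) (thrSet 𝒰 𝒱 𝒲 e (mk 2 2 0)))
      (ih3 : InK (thrSet 𝒰 𝒱 𝒲 e (mk 0 0 2)) (thrSet 𝒰 𝒱 𝒲 e (mk 0 2 0)) (thrSet 𝒰 𝒱 𝒲 e (mk 2 0 0)))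
      (ih4 : InK (thrSet 𝒰 𝒱 𝒲 e (mk 0 1 2)) (thrSet 𝒰 𝒱 𝒲 e (mk 0 2 0)) (thrSet 𝒰 𝒱 𝒲 e (mk 2 0 0))) : InK 𝒰 𝒱 𝒲

/-- **(M⁺-3) ON THE RECURSIVE CLASS: every triple of `𝒦` has nonnegative twisted three-partition functional for EVERY twist.**
Structural induction: base strata from the tree (`threePartNT_principal_nonneg`, `threePartNT_empty_left`, `threePartNT_nonneg_of_nested`),
slot symmetries (`threePartNT_swap12/23`), CONE (`threePartNT_lift_le_three_mul` / `two_mul_threePartNT_lift_le_three_mul`, the minor taken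
at the twist `τ ∖ e`), and the kernel-checked certificate steps ONE-NESTED / ONE-MEET / ZERO-EQUAL / ZERO-NESTED / COMMON-CORE / CYCLIC / PAIRWISE-ZERO-MEET / EQUAL-ZERO-MEETS / MAX-CLASS-25. [this work] -/
theorem InK.threePartNT_nonneg {𝒰 𝒱 𝒲 : Set (Set ι)} (h : InK 𝒰 𝒱 𝒲) (τ : Set ι) : 0 ≤ threePartNT τ 𝒰 𝒱 𝒲 := by
  induction h generalizing τ with
  | principal S h𝒱 h𝒲 => exact threePartNT_principal_nonneg τ S h𝒱 h𝒲
  | empty h𝒱 h𝒲 => rw [threePartNT_empty_left]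
  | nested h𝒰 h𝒱 h𝒲 h => exact threePartNT_nonneg_of_nested τ h𝒰 h𝒱 h𝒲 h
  | strata U hU h => exact threePartNT_nonneg_of_not_residual τ U hU h
  | cert e h𝒰 h𝒱 h𝒲 R dA dB LA LB IA IB hdA hdB hokA hokB hchkA hchkB hreal _ ih =>
    by_cases he : e ∈ τ
    · refine threePartNT_nonneg_of_cert _ _ _ e τ h𝒰 h𝒱 h𝒲 hdB (L := LB) (I := IB) (cls := inM R) hokB ?_ hreal ?_
      · rw [decide_eq_true he]; exact hchkB
      · exact fun p hp => ih p (List.mem_append_right _ hp) τ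
    · refine threePartNT_nonneg_of_cert _ _ _ e τ h𝒰 h𝒱 h𝒲 hdA (L := LA) (I := IA) (cls := inM R) hokA ?_ hreal ?_
      · rw [decide_eq_false he]; exact hchkA
      · exact fun p hp => ih p (List.mem_append_left _ hp) τ
  | swap12 _ ih => rw [threePartNT_swap12]; exact ih τ
  | swap23 _ ih => rw [threePartNT_swap23]; exact ih τ
  | cone e h𝒰 h𝒱 h𝒲 he _ ih =>
    by_cases heτ : e ∈ τ
    · have hne : e ∉ τ \ {e} := fun h => h.2 rfl
      have h3 := two_mul_threePartNT_lift_le_three_mul (τ \ {e}) e hne h𝒰 h𝒱 h𝒲 he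
      rw [insert_sdiff_singleton_of_mem heτ] at h3
      have h0 := ih (τ \ {e})
      linarith
    · have h3 := threePartNT_lift_le_three_mul τ e heτ h𝒰 h𝒱 h𝒲 he
      have h0 := ih τ
      linarith
  | oneNested e h𝒰 h𝒱 h𝒲 hUV _ ih => exact threePartNT_nonneg_of_oneNested e τ h𝒰 h𝒱 h𝒲 hUV (ih τ)
  | oneMeet e h𝒰 h𝒱 h𝒲 hm _ _ ih1 ih2 => exact threePartNT_nonneg_of_oneMeet e τ h𝒰 h𝒱 h𝒲 hm (ih1 τ) (ih2 τ)
  | zeroNested e h𝒰 h𝒱 h𝒲 hzn _ ih => exact threePartNT_nonneg_of_zeroNested e τ h𝒰 h𝒱 h𝒲 hzn (ih τ)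
  | zeroEqual e h𝒰 h𝒱 h𝒲 hz _ _ _ _ _ ih1 ih2 ih3 ih4 ih5 =>
    exact threePartNT_nonneg_of_zeroEqual e τ h𝒰 h𝒱 h𝒲 hz (ih1 τ) (ih2 τ) (ih3 τ) (ih4 τ) (ih5 τ)
  | pairwiseMeet e h𝒰 h𝒱 h𝒲 hUV hUW hVW _ _ _ _ _ _ _ ih1 ih2 ih3 ih4 ih5 ih6 ih7 =>
    exact threePartNT_nonneg_of_pairwiseMeet e τ h𝒰 h𝒱 h𝒲 hUV hUW hVW (ih1 τ) (ih2 τ) (ih3 τ) (ih4 τ) (ih5 τ) (ih6 τ) (ih7 τ)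
  | equalZeroMeets e h𝒰 h𝒱 h𝒲 hUV hUW _ _ _ ih1 ih2 ih3 =>
    exact threePartNT_nonneg_of_equalZeroMeets e τ h𝒰 h𝒱 h𝒲 hUV hUW (ih1 τ) (ih2 τ) (ih3 τ)
  | maxClass25 e h𝒰 h𝒱 h𝒲 h011 h122 _ _ _ _ ih1 ih2 ih3 ih4 =>
    exact threePartNT_nonneg_of_maxClass25 e τ h𝒰 h𝒱 h𝒲 h011 h122 (ih1 τ) (ih2 τ) (ih3 τ) (ih4 τ)
  | commonCore e h𝒰 h𝒱 h𝒲 hcc _ _ _ ih1 ih2 ih3 =>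
    exact threePartNT_nonneg_of_commonCore e τ h𝒰 h𝒱 h𝒲 hcc (ih1 τ) (ih2 τ) (ih3 τ)
  | cyclic e h𝒰 h𝒱 h𝒲 hUV hVW hWU _ _ _ _ ih1 ih2 ih3 ih4 =>
    exact threePartNT_nonneg_of_cyclic e τ h𝒰 h𝒱 h𝒲 hUV hVW hWU (ih1 τ) (ih2 τ) (ih3 τ) (ih4 τ)

end RecursiveClass

/-! ## From the class to comb positivity of `E₃` -/

section Comb

open Literature.Combinatorics.Sahi2008
open Literature.Probability.Percolation.DecisionTree (ind)
open SahiComb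

variable {ι : Type} [Fintype ι]

/-- **Comb positivity of `E₃` from `𝒦`-membership of all subcube sections.**  If for every profile `j ≤ 3` the section triple of
`(U, V, W)` on the active coordinates (`secFam j`, `…ThreePartitionCombBridge`: coordinates with `j_e = 3` contracted, `j_e = 0` deleted)
lies in `𝒦`, then `p ↦ E₃(μ_p; 1_U, 1_V, 1_W)` is a nonnegative combination of the degree-3 tensor-Bernstein basis (hence `≥ 0` at
every product measure). [this work] -/
theorem combPos_sahiE_three_of_inK_sections {U V W : Set (Set ι)}
    (h : ∀ j : ι → ℕ, (∀ e, j e ≤ 3) → InK (secFam j U) (secFam j V) (secFam j W)) :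
    CombPos (fun _ : ι => 3) (fun p => sahiE (bernoulliWeight p) 3 ![ind U, ind V, ind W]) := by
  refine combPos_sahiE_three_of_combCoef3_nonneg fun j => ?_
  by_cases hj : ∀ e, j e ≤ 3
  · rw [combCoef3_eq_threePartNT U V W hj]
    exact_mod_cast (h j hj).threePartNT_nonneg (twist j)
  · rw [combCoef3_eq_zero_of_not_le _ _ _ hj]

end Comb

end TypedSlice

end Summit.CriticalPhenomena.PercolationContinuityZ3.Theorems.ThreePartition
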